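import Literature.Geometry.GeometricMeasureTheory.HausdorffDensity
import Mathlib.MeasureTheory.Covering.BesicovitchVectorSpace
import Mathlib.MeasureTheory.Measure.Hausdorff
import HarnessLib

/-!
# The spherical measure `𝓢ⁿ` and the sharp upper density bound `Θ^{*n}(𝓢ⁿ ⌞ M, x) ≤ 1`

Federer's **spherical measure** `𝓢ⁿ` [Federer1969, 2.10.2 (2)] is the result of Carathéodory's
construction (2.10.1) applied to the family of all balls with the gauge `ζ(𝐁(x, r)) = α(n) rⁿ`
(`α(n) = unitBallVolume n`, the volume of the unit ball of `ℝⁿ`). We realise it with Mathlib's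
`MeasureTheory.Measure.mkMetric'` and the **circumball gauge**
`ζₙ(S) = inf {α(n) rⁿ : S ⊆ 𝐁(x, r)}` on all sets (a set costs as much as its cheapest enclosing
closed ball; since `ζₙ` is monotone and a cover by balls is a cover by sets, this is the same
measure). Main results:

* `sphericalGauge`, `sphericalMeasure` — the definitions; `sphericalMeasure_apply` (the measure of
  ANY set is the value of the metric outer measure, the gauge being closure-invariant);
* `sphericalMeasure_le_mul_hausdorffMeasure`, `hausdorffMeasure_le_mul_sphericalMeasure` —
  `𝓢ⁿ ≤ α(n) 𝓗ⁿ` and `𝓗ⁿ ≤ 2ⁿ α(n)⁻¹ 𝓢ⁿ` for Mathlib's (unnormalised) Hausdorff measure `μH[n]`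
  [Federer1969, 2.10.6: `𝓗ⁿ ≤ 𝓢ⁿ ≤ 2ⁿ 𝓗ⁿ` in Federer's normalisation], so the two measures have
  the same null sets and the same sets of finite measure;
* **`ae_upperDensity_sphericalMeasure_restrict_le_one`** — Federer 2.10.19 (5) for `𝓢ⁿ`, with the
  SHARP constant: if `M` is measurable with `𝓢ⁿ(M) < ∞` then `Θ^{*n}(𝓢ⁿ ⌞ M, x) ≤ 1` for
  `𝓢ⁿ ⌞ M`-a.e. `x` ("if `A ⊂ X` and `φ(A) < ∞` then `Θ^{*m}(φ ⌞ A, x) ≤ 1` for `𝓢^m` almost all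
  `x`", here `φ = 𝓢ⁿ`). Proof: on `A_t = {x ∈ M : Θ^{*n} > t}`, `t > 1`, the closed balls
  `𝐁(x, r) ⊆ U` with `𝓢ⁿ(M ∩ 𝐁(x,r)) > t α(n) rⁿ` form a fine cover; the measurable Besicovitch
  covering theorem (Mathlib) extracts a disjoint subfamily covering `𝓢ⁿ ⌞ M`-almost all of `A_t`,
  whence `𝓢ⁿ_δ(A_t) ≤ Σ α(n) rᵢⁿ < t⁻¹ 𝓢ⁿ(M ∩ U) ≤ t⁻¹ (𝓢ⁿ(A_t) + ε)` and `𝓢ⁿ(A_t) = 0`.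
  Because the extracted cover consists of BALLS, whose gauge is `α(n) rⁿ` by definition, no
  isodiametric inequality is needed (for `𝓗ⁿ` the sharp constant is the isodiametric inequality,
  2.10.33, a `proof_wanted` in Mathlib).

The sharp bound is the form used in B. White's proof of the closure theorem for integral
currents [White1989, p. 213: "`Θ*(M, x) ≤ 1` for `𝓗ᵏ` almost every `x ∈ M`"], which we run with
`𝓢ⁿ` in place of `𝓗ⁿ`.

## References

* H. Federer, *Geometric Measure Theory*, Springer 1969, 2.10.1, 2.10.2, 2.10.6, 2.10.19 (5)
  (held copy `lit book:federernd-geometric-measure-theory`) [Federer1969].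
* B. White, *A new proof of the compactness theorem for integral currents*, Comment. Math. Helv.
  64 (1989) 207–220 [White1989].
-/

noncomputable section

open scoped ENNReal NNReal Topology
open MeasureTheory MeasureTheory.Measure TopologicalSpace Set Filter Metric

namespace Literature.Geometry.GeometricMeasureTheory

/-! ### The circumball gauge and the spherical measure -/

section Defs

variable {X : Type*} [MetricSpace X]

/-- **The circumball gauge** `ζₙ(S) = inf {α(n) rⁿ : S ⊆ 𝐁(x, r)}`: the Carathéodory gauge of the
spherical measure, extended from balls to all sets by taking the cheapest enclosing closed ball.
[cite: Federer1969, 2.10.2 (2)] -/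
def sphericalGauge (n : ℕ) (S : Set X) : ℝ≥0∞ :=
  ⨅ (x : X) (r : ℝ) (_ : S ⊆ closedBall x r), unitBallVolume n * ENNReal.ofReal r ^ n

/-- `ζₙ(S) ≤ α(n) rⁿ` when `S ⊆ 𝐁(x, r)`. [cite: Federer1969, 2.10.2 (2)] -/
theorem sphericalGauge_le_of_subset_closedBall {n : ℕ} {S : Set X} {x : X} {r : ℝ}
    (h : S ⊆ closedBall x r) : sphericalGauge n S ≤ unitBallVolume n * ENNReal.ofReal r ^ n :=
  iInf_le_of_le x (iInf_le_of_le r (iInf_le_of_le h le_rfl))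

/-- Lower bounds for the gauge: `c ≤ ζₙ(S)` iff `c ≤ α(n) rⁿ` for every enclosing ball.
[cite: Federer1969, 2.10.2 (2)] -/
theorem le_sphericalGauge_iff {n : ℕ} {S : Set X} {c : ℝ≥0∞} :
    c ≤ sphericalGauge n S ↔
      ∀ (x : X) (r : ℝ), S ⊆ closedBall x r → c ≤ unitBallVolume n * ENNReal.ofReal r ^ n := by
  simp only [sphericalGauge, le_iInf_iff]

/-- The gauge is monotone. [cite: Federer1969, 2.10.2 (2)] -/
theorem sphericalGauge_mono {n : ℕ} {S S' : Set X} (h : S ⊆ S') :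
    sphericalGauge n S ≤ sphericalGauge n S' :=
  le_sphericalGauge_iff.2 fun _ _ hS' => sphericalGauge_le_of_subset_closedBall (h.trans hS')

/-- The gauge does not see the difference between a set and its closure (closed balls are
closed). [cite: Federer1969, 2.10.2 (2)] -/
theorem sphericalGauge_closure {n : ℕ} (S : Set X) :
    sphericalGauge n (closure S) = sphericalGauge n S := by
  refine le_antisymm (le_sphericalGauge_iff.2 fun x r h => ?_) (sphericalGauge_mono subset_closure)
  exact sphericalGauge_le_of_subset_closedBall (closure_minimal h isClosed_closedBall)

variable [MeasurableSpace X] [BorelSpace X]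

/-- **The spherical measure** `𝓢ⁿ`: Carathéodory's construction from balls with `ζ(𝐁(x,r)) =
α(n) rⁿ`, realised as `Measure.mkMetric'` of the circumball gauge. [cite: Federer1969, 2.10.2 (2)] -/
def sphericalMeasure (n : ℕ) : Measure X :=
  Measure.mkMetric' (sphericalGauge n)

/-- The outer measure of `𝓢ⁿ` is the metric outer measure `mkMetric' ζₙ` itself (the
pre-measures are trimmed because `ζₙ` is closure-invariant). [cite: Federer1969, 2.10.1] -/
theorem toOuterMeasure_sphericalMeasure (n : ℕ) :
    (sphericalMeasure n : Measure X).toOuterMeasure = OuterMeasure.mkMetric' (sphericalGauge n) := by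
  have hcl : ∀ S : Set X, sphericalGauge n (closure S) = sphericalGauge n S :=
    fun S => sphericalGauge_closure S
  rw [sphericalMeasure, Measure.mkMetric'_toOuterMeasure, OuterMeasure.mkMetric'.eq_iSup_nat,
    OuterMeasure.trim_iSup]
  exact iSup_congr fun k => OuterMeasure.mkMetric'.trim_pre (sphericalGauge n) hcl _

/-- The value of `𝓢ⁿ` on ANY set is the value of the metric outer measure `mkMetric' ζₙ`.
[cite: Federer1969, 2.10.1] -/
theorem sphericalMeasure_apply (n : ℕ) (s : Set X) :
    (sphericalMeasure n : Measure X) s = OuterMeasure.mkMetric' (sphericalGauge n) s := by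
  rw [← toOuterMeasure_sphericalMeasure]; rfl

/-- `𝓢ⁿ(s) = sup_k 𝓢ⁿ_{1/k}(s)`: the measure is the supremum of the size-`k⁻¹` approximating
pre-measures. [cite: Federer1969, 2.10.1] -/
theorem sphericalMeasure_eq_iSup (n : ℕ) (s : Set X) :
    (sphericalMeasure n : Measure X) s =
      ⨆ k : ℕ, OuterMeasure.mkMetric'.pre (sphericalGauge (X := X) n) (k : ℝ≥0∞)⁻¹ s := by
  rw [sphericalMeasure_apply, OuterMeasure.mkMetric'.eq_iSup_nat, OuterMeasure.iSup_apply]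

/-- Every approximating pre-measure is below `𝓢ⁿ`. [cite: Federer1969, 2.10.1] -/
theorem pre_le_sphericalMeasure (n : ℕ) {δ : ℝ≥0∞} (hδ : 0 < δ) (s : Set X) :
    OuterMeasure.mkMetric'.pre (sphericalGauge (X := X) n) δ s ≤ (sphericalMeasure n : Measure X) s := by
  rw [sphericalMeasure_apply, OuterMeasure.mkMetric']
  exact (le_iSup₂ (f := fun r (_ : 0 < r) => OuterMeasure.mkMetric'.pre (sphericalGauge (X := X) n) r)
    δ hδ :) s

omit [MeasurableSpace X] [BorelSpace X] in
/-- **Covering bound**: if `A` is covered by countably many closed balls `𝐁(xᵢ, rᵢ)` with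
`2 rᵢ ≤ δ`, then `𝓢ⁿ_δ(A) ≤ Σᵢ α(n) rᵢⁿ`. [cite: Federer1969, 2.10.1, 2.10.2 (2)] -/
theorem pre_sphericalGauge_le_tsum {n : ℕ} {ι : Type*} [Countable ι] {A : Set X} (x : ι → X)
    (r : ι → ℝ) {δ : ℝ≥0∞} (hδ : ∀ i, ENNReal.ofReal (2 * r i) ≤ δ)
    (hA : A ⊆ ⋃ i, closedBall (x i) (r i)) :
    OuterMeasure.mkMetric'.pre (sphericalGauge (X := X) n) δ A ≤
      ∑' i, unitBallVolume n * ENNReal.ofReal (r i) ^ n := by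
  set μ := OuterMeasure.mkMetric'.pre (sphericalGauge (X := X) n) δ with hμ
  calc μ A ≤ μ (⋃ i, closedBall (x i) (r i)) := μ.mono hA
    _ ≤ ∑' i, μ (closedBall (x i) (r i)) := measure_iUnion_le _
    _ ≤ ∑' i, unitBallVolume n * ENNReal.ofReal (r i) ^ n := by
        refine ENNReal.tsum_le_tsum fun i => ?_
        refine (OuterMeasure.mkMetric'.pre_le ?_).trans
          (sphericalGauge_le_of_subset_closedBall Subset.rfl)
        refine (Metric.ediam_le fun y hy z hz => ?_).trans (hδ i)
        rw [edist_dist]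
        apply ENNReal.ofReal_le_ofReal
        calc dist y z ≤ dist y (x i) + dist z (x i) := dist_triangle_right _ _ _
          _ ≤ r i + r i := add_le_add (mem_closedBall.1 hy) (mem_closedBall.1 hz)
          _ = 2 * r i := by ring

end Defs

/-! ### Comparison of two Carathéodory constructions -/

section Compare

variable {X : Type*} [EMetricSpace X]

/-- If `m₁ ≤ c m₂` on nonempty sets of diameter `≤ δ` (`c ≠ 0, ∞`), then the size-`δ`
pre-measures satisfy `pre m₁ δ ≤ c • pre m₂ δ`. [cite: Federer1969, 2.10.1] -/
theorem OuterMeasure.mkMetric'.pre_le_smul_pre {m₁ m₂ : Set X → ℝ≥0∞} {c : ℝ≥0∞} (hc0 : c ≠ 0)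
    (hctop : c ≠ ⊤) {δ : ℝ≥0∞}
    (h : ∀ s : Set X, s.Nonempty → Metric.ediam s ≤ δ → m₁ s ≤ c * m₂ s) :
    OuterMeasure.mkMetric'.pre m₁ δ ≤ c • OuterMeasure.mkMetric'.pre m₂ δ := by
  have h1 : c⁻¹ • OuterMeasure.mkMetric'.pre m₁ δ ≤ OuterMeasure.mkMetric'.pre m₂ δ := by
    refine OuterMeasure.mkMetric'.le_pre.2 fun s hs => ?_
    rw [_root_.smul_apply, smul_eq_mul]
    rcases s.eq_empty_or_nonempty with rfl | hne
    · simp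
    calc c⁻¹ * OuterMeasure.mkMetric'.pre m₁ δ s ≤ c⁻¹ * m₁ s := by
          gcongr; exact OuterMeasure.mkMetric'.pre_le hs
      _ ≤ c⁻¹ * (c * m₂ s) := by gcongr; exact h s hne hs
      _ = m₂ s := by rw [← mul_assoc, ENNReal.inv_mul_cancel hc0 hctop, one_mul]
  intro s
  have h2 := h1 s
  rw [_root_.smul_apply, smul_eq_mul] at h2 ⊢
  calc OuterMeasure.mkMetric'.pre m₁ δ s = c * (c⁻¹ * OuterMeasure.mkMetric'.pre m₁ δ s) := by
        rw [← mul_assoc, ENNReal.mul_inv_cancel hc0 hctop, one_mul]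
    _ ≤ c * OuterMeasure.mkMetric'.pre m₂ δ s := by gcongr

/-- If `m₁ ≤ c m₂` on nonempty sets of diameter `≤ 1` (`c ≠ 0, ∞`), then
`mkMetric' m₁ ≤ c • mkMetric' m₂` (only small sets matter). [cite: Federer1969, 2.10.1] -/
theorem OuterMeasure.mkMetric'_le_smul {m₁ m₂ : Set X → ℝ≥0∞} {c : ℝ≥0∞} (hc0 : c ≠ 0)
    (hctop : c ≠ ⊤) (h : ∀ s : Set X, s.Nonempty → Metric.ediam s ≤ 1 → m₁ s ≤ c * m₂ s)
    (s : Set X) : OuterMeasure.mkMetric' m₁ s ≤ c * OuterMeasure.mkMetric' m₂ s := by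
  simp only [OuterMeasure.mkMetric', OuterMeasure.iSup_apply]
  refine iSup₂_le fun r hr => ?_
  have hr1 : 0 < min r 1 := lt_min hr one_pos
  calc OuterMeasure.mkMetric'.pre m₁ r s ≤ OuterMeasure.mkMetric'.pre m₁ (min r 1) s :=
        OuterMeasure.mkMetric'.mono_pre m₁ (min_le_left r 1) s
    _ ≤ c * OuterMeasure.mkMetric'.pre m₂ (min r 1) s := by
        have := OuterMeasure.mkMetric'.pre_le_smul_pre hc0 hctop (δ := min r 1) (m₁ := m₁)
          (m₂ := m₂) fun s hs hsd => h s hs (hsd.trans (min_le_right r 1))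
        simpa using this s
    _ ≤ c * ⨆ (r : ℝ≥0∞) (_ : 0 < r), OuterMeasure.mkMetric'.pre m₂ r s := by
        gcongr
        exact le_iSup₂_of_le (min r 1) hr1 le_rfl

end Compare

/-! ### `𝓢ⁿ` versus `𝓗ⁿ` -/

section Hausdorff

variable {X : Type*} [MetricSpace X] [MeasurableSpace X] [BorelSpace X]

omit [MeasurableSpace X] [BorelSpace X] in
/-- The diameter of a closed ball of radius `r` is at most `2r`. [folklore] -/
private theorem ediam_closedBall_le (x : X) (r : ℝ) :
    Metric.ediam (closedBall x r) ≤ ENNReal.ofReal (2 * r) := by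
  refine Metric.ediam_le fun y hy z hz => ?_
  rw [edist_dist]
  apply ENNReal.ofReal_le_ofReal
  calc dist y z ≤ dist y x + dist z x := dist_triangle_right _ _ _
    _ ≤ r + r := add_le_add (mem_closedBall.1 hy) (mem_closedBall.1 hz)
    _ = 2 * r := by ring

omit [MeasurableSpace X] [BorelSpace X] in
/-- `ζₙ(S) ≤ α(n) (diam S)ⁿ` for a nonempty bounded set: it lies in the closed ball of radius
`diam S` about any of its points. [cite: Federer1969, 2.10.6] -/
theorem sphericalGauge_le_mul_ediam_pow (n : ℕ) {S : Set X} (hS : S.Nonempty)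
    (htop : Metric.ediam S ≠ ⊤) :
    sphericalGauge n S ≤ unitBallVolume n * Metric.ediam S ^ n := by
  obtain ⟨x, hx⟩ := hS
  have hb : Bornology.IsBounded S := Metric.isBounded_iff_ediam_ne_top.2 htop
  refine (sphericalGauge_le_of_subset_closedBall (x := x) (r := Metric.diam S) fun y hy =>
    mem_closedBall.2 (Metric.dist_le_diam_of_mem hb hy hx)).trans ?_
  rw [Metric.diam, ENNReal.ofReal_toReal htop]

omit [MeasurableSpace X] [BorelSpace X] in
/-- `α(n) 2⁻ⁿ (diam S)ⁿ ≤ ζₙ(S)`: a set inside `𝐁(x, r)` has diameter `≤ 2r`.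
[cite: Federer1969, 2.10.6] -/
theorem mul_ediam_pow_le_sphericalGauge (n : ℕ) (S : Set X) :
    unitBallVolume n * (2 ^ n)⁻¹ * Metric.ediam S ^ n ≤ sphericalGauge n S := by
  refine le_sphericalGauge_iff.2 fun x r h => ?_
  have h1 : Metric.ediam S ^ n ≤ 2 ^ n * ENNReal.ofReal r ^ n := by
    calc Metric.ediam S ^ n ≤ (ENNReal.ofReal (2 * r)) ^ n := by
          gcongr
          exact (Metric.ediam_mono h).trans (ediam_closedBall_le x r)
      _ = 2 ^ n * ENNReal.ofReal r ^ n := by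
          rw [ENNReal.ofReal_mul (by norm_num : (0 : ℝ) ≤ 2), mul_pow]
          norm_num
  calc unitBallVolume n * (2 ^ n)⁻¹ * Metric.ediam S ^ n
      ≤ unitBallVolume n * (2 ^ n)⁻¹ * (2 ^ n * ENNReal.ofReal r ^ n) := by gcongr
    _ = unitBallVolume n * ENNReal.ofReal r ^ n := by
        rw [← mul_assoc, mul_assoc (unitBallVolume n),
          ENNReal.inv_mul_cancel (pow_ne_zero _ two_ne_zero) (ENNReal.pow_ne_top (by norm_num)),
          mul_one]

/-- **`𝓢ⁿ ≤ α(n) 𝓗ⁿ`** (Mathlib's unnormalised `μH[n]`; Federer's `𝓢ⁿ ≤ 2ⁿ 𝓗ⁿ`).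
[cite: Federer1969, 2.10.6] -/
theorem sphericalMeasure_le_mul_hausdorffMeasure (n : ℕ) (s : Set X) :
    (sphericalMeasure n : Measure X) s ≤ unitBallVolume n * μH[n] s := by
  rw [sphericalMeasure_apply, show (μH[(n : ℝ)] : Measure X) = Measure.mkMetric fun r => r ^ (n : ℝ)
    from rfl, ← OuterMeasure.coe_mkMetric]
  refine OuterMeasure.mkMetric'_le_smul (unitBallVolume_ne_zero n) (unitBallVolume_ne_top n)
    (fun S hS hS1 => ?_) s
  simp only [ENNReal.rpow_natCast]
  exact sphericalGauge_le_mul_ediam_pow n hS (ne_top_of_le_ne_top ENNReal.one_ne_top hS1)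

/-- **`𝓗ⁿ ≤ 2ⁿ α(n)⁻¹ 𝓢ⁿ`** (Mathlib's unnormalised `μH[n]`; Federer's `𝓗ⁿ ≤ 𝓢ⁿ`).
[cite: Federer1969, 2.10.6] -/
theorem hausdorffMeasure_le_mul_sphericalMeasure (n : ℕ) (s : Set X) :
    μH[n] s ≤ 2 ^ n * (unitBallVolume n)⁻¹ * (sphericalMeasure n : Measure X) s := by
  have hα0 := unitBallVolume_ne_zero n
  have hαtop := unitBallVolume_ne_top n
  have h2 : (2 : ℝ≥0∞) ^ n ≠ 0 := pow_ne_zero _ two_ne_zero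
  have h2t : (2 : ℝ≥0∞) ^ n ≠ ⊤ := ENNReal.pow_ne_top (by norm_num)
  rw [sphericalMeasure_apply, show (μH[(n : ℝ)] : Measure X) = Measure.mkMetric fun r => r ^ (n : ℝ)
    from rfl, ← OuterMeasure.coe_mkMetric]
  refine OuterMeasure.mkMetric'_le_smul (mul_ne_zero h2 (ENNReal.inv_ne_zero.2 hαtop))
    (ENNReal.mul_ne_top h2t (ENNReal.inv_ne_top.2 hα0)) (fun S _ _ => ?_) s
  simp only [ENNReal.rpow_natCast]
  calc Metric.ediam S ^ n
      = 2 ^ n * (unitBallVolume n)⁻¹ * (unitBallVolume n * (2 ^ n)⁻¹ * Metric.ediam S ^ n) := by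
        rw [show 2 ^ n * (unitBallVolume n)⁻¹ * (unitBallVolume n * (2 ^ n)⁻¹ * Metric.ediam S ^ n)
            = (2 ^ n * (2 ^ n)⁻¹) * ((unitBallVolume n)⁻¹ * unitBallVolume n) *
              Metric.ediam S ^ n by ring, ENNReal.mul_inv_cancel h2 h2t,
          ENNReal.inv_mul_cancel hα0 hαtop, one_mul, one_mul]
    _ ≤ 2 ^ n * (unitBallVolume n)⁻¹ * sphericalGauge n S := by
        gcongr; exact mul_ediam_pow_le_sphericalGauge n S

/-- `𝓢ⁿ` and `𝓗ⁿ` have the same null sets. [cite: Federer1969, 2.10.6] -/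
theorem sphericalMeasure_eq_zero_iff (n : ℕ) (s : Set X) :
    (sphericalMeasure n : Measure X) s = 0 ↔ μH[n] s = 0 := by
  constructor <;> intro h
  · have := hausdorffMeasure_le_mul_sphericalMeasure n s
    rw [h, mul_zero] at this
    exact nonpos_iff_eq_zero.1 this
  · have := sphericalMeasure_le_mul_hausdorffMeasure n s
    rw [h, mul_zero] at this
    exact nonpos_iff_eq_zero.1 this

/-- `𝓢ⁿ` and `𝓗ⁿ` are finite on the same sets. [cite: Federer1969, 2.10.6] -/
theorem sphericalMeasure_ne_top_iff (n : ℕ) (s : Set X) :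
    (sphericalMeasure n : Measure X) s ≠ ⊤ ↔ μH[n] s ≠ ⊤ := by
  constructor <;> intro h
  · refine ne_top_of_le_ne_top ?_ (hausdorffMeasure_le_mul_sphericalMeasure n s)
    exact ENNReal.mul_ne_top (ENNReal.mul_ne_top (ENNReal.pow_ne_top (by norm_num))
      (ENNReal.inv_ne_top.2 (unitBallVolume_ne_zero n))) h
  · exact ne_top_of_le_ne_top (ENNReal.mul_ne_top (unitBallVolume_ne_top n) h)
      (sphericalMeasure_le_mul_hausdorffMeasure n s)

/-- `𝓢ⁿ ≪ 𝓗ⁿ` and `𝓗ⁿ ≪ 𝓢ⁿ`. [cite: Federer1969, 2.10.6] -/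
theorem sphericalMeasure_absolutelyContinuous_hausdorffMeasure (n : ℕ) :
    (sphericalMeasure n : Measure X) ≪ μH[n] ∧ (μH[n] : Measure X) ≪ (sphericalMeasure n : Measure X) :=
  ⟨fun s hs => (sphericalMeasure_eq_zero_iff n s).2 hs,
    fun s hs => (sphericalMeasure_eq_zero_iff n s).1 hs⟩

end Hausdorff

/-! ### The sharp upper density bound (Federer 2.10.19 (5)) -/

section Density

variable {V : Type*} [NormedAddCommGroup V] [NormedSpace ℝ V] [FiniteDimensional ℝ V]
  [MeasurableSpace V] [BorelSpace V] {n : ℕ}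

/-- The core of 2.10.19 (5): for `M` measurable with `𝓢ⁿ(M) < ∞` and `1 < t < ∞`, the set of
points of `M` where `Θ^{*n}(𝓢ⁿ ⌞ M, ·) > t` is `𝓢ⁿ`-null (Besicovitch covering by the balls
`𝐁(x, r) ⊆ U` with `𝓢ⁿ(M ∩ 𝐁(x,r)) > t α(n) rⁿ`). [cite: Federer1969, 2.10.19 (5)] -/
theorem sphericalMeasure_setOf_lt_upperDensity_inter_eq_zero {M : Set V} (hM : MeasurableSet M)
    (hfin : (sphericalMeasure n : Measure V) M ≠ ⊤) {t : ℝ≥0∞} (ht : 1 < t) (httop : t ≠ ⊤) :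
    (sphericalMeasure n : Measure V)
      ({x | t < upperDensity n ((sphericalMeasure n : Measure V).restrict M) x} ∩ M) = 0 := by
  set 𝓢 : Measure V := (sphericalMeasure n : Measure V) with h𝓢
  set σ := 𝓢.restrict M with hσ
  haveI : IsFiniteMeasure σ := by
    rw [hσ, isFiniteMeasure_restrict]; exact hfin
  set A := {x | t < upperDensity n σ x} ∩ M with hA
  have hAM : A ⊆ M := inter_subset_right
  have hσA : ∀ E ⊆ M, σ E = 𝓢 E := fun E hE => by
    rw [hσ, Measure.restrict_apply' hM, inter_eq_self_of_subset_left hE]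
  have hAfin : 𝓢 A ≠ ⊤ := ne_top_of_le_ne_top hfin (measure_mono hAM)
  have ht0 : t ≠ 0 := (zero_lt_one.trans ht).ne'
  have hα0 : unitBallVolume n ≠ 0 := unitBallVolume_ne_zero n
  have hαtop : unitBallVolume n ≠ ⊤ := unitBallVolume_ne_top n
  -- Main estimate: `𝓢 A ≤ t⁻¹ (𝓢 A + ε)` for every `ε > 0`.
  have hmain : ∀ ε : ℝ≥0∞, ε ≠ 0 → 𝓢 A ≤ t⁻¹ * (𝓢 A + ε) := by
    intro ε hε
    -- an open `U ⊇ A` with `σ U < σ A + ε`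
    obtain ⟨U, hAU, hUo, hσU⟩ := Set.exists_isOpen_lt_of_lt A (σ A + ε)
      (ENNReal.lt_add_right ((hσA A hAM).symm ▸ hAfin) hε)
    -- the fine cover
    have hf : ∀ x ∈ A, ∀ η > (0 : ℝ), ({r : ℝ | closedBall x r ⊆ U ∧
        t * (unitBallVolume n * ENNReal.ofReal r ^ n) < σ (closedBall x r)} ∩ Ioo 0 η).Nonempty := by
      intro x hx η hη
      have h1 : ∃ᶠ r in 𝓝[>] (0 : ℝ),
          t < σ (closedBall x r) / (unitBallVolume n * ENNReal.ofReal (r ^ n)) :=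
        frequently_lt_of_lt_limsup (by isBoundedDefault) hx.1
      obtain ⟨ρ, hρ, hρU⟩ := Metric.nhds_basis_closedBall.mem_iff.1 (hUo.mem_nhds (hAU hx))
      have h2 : ∀ᶠ r in 𝓝[>] (0 : ℝ), 0 < r ∧ r < η ∧ closedBall x r ⊆ U := by
        filter_upwards [Ioo_mem_nhdsGT (lt_min hη hρ)] with r hr
        exact ⟨hr.1, hr.2.trans_le (min_le_left _ _),
          (closedBall_subset_closedBall (hr.2.trans_le (min_le_right _ _)).le).trans hρU⟩
      obtain ⟨r, hr1, hr2, hr3, hr4⟩ := (h1.and_eventually h2).exists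
      refine ⟨r, ⟨hr4, ?_⟩, hr2, hr3⟩
      have hb0 : unitBallVolume n * ENNReal.ofReal (r ^ n) ≠ 0 :=
        mul_ne_zero hα0 (ENNReal.ofReal_pos.2 (pow_pos hr2 n)).ne'
      have hbtop : unitBallVolume n * ENNReal.ofReal (r ^ n) ≠ ⊤ :=
        ENNReal.mul_ne_top hαtop ENNReal.ofReal_ne_top
      rw [ENNReal.ofReal_pow hr2.le] at hr1 hb0 hbtop
      exact (ENNReal.lt_div_iff_mul_lt (Or.inl hb0) (Or.inl hbtop)).1 hr1
    -- for every mesh `δ > 0`: `𝓢_{2δ}(A) ≤ t⁻¹ (𝓢 A + ε)`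
    have hδ : ∀ δ : ℝ, 0 < δ → OuterMeasure.mkMetric'.pre (sphericalGauge n)
        (ENNReal.ofReal (2 * δ)) A ≤ t⁻¹ * (𝓢 A + ε) := by
      intro δ hδ
      obtain ⟨c, r, hcc, hcA, hr, hcov, hdisj⟩ :=
        Besicovitch.exists_disjoint_closedBall_covering_ae σ _ A hf (fun _ => δ) fun _ _ => hδ
      haveI : Countable c := hcc.to_subtype
      set B : c → Set V := fun x => closedBall (x : V) (r x) with hB
      have hrpos : ∀ x : c, 0 < r x := fun x => (hr x x.2).2.1
      have hrδ : ∀ x : c, r x < δ := fun x => (hr x x.2).2.2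
      have hBU : ∀ x : c, B x ⊆ U := fun x => (hr x x.2).1.1
      have hBt : ∀ x : c, t * (unitBallVolume n * ENNReal.ofReal (r x) ^ n) < σ (B x) :=
        fun x => (hr x x.2).1.2
      -- split `A` into the covered part and the `σ`-null rest
      have hsplit : OuterMeasure.mkMetric'.pre (sphericalGauge n) (ENNReal.ofReal (2 * δ)) A ≤
          OuterMeasure.mkMetric'.pre (sphericalGauge n) (ENNReal.ofReal (2 * δ)) (⋃ x : c, B x) +
          OuterMeasure.mkMetric'.pre (sphericalGauge n) (ENNReal.ofReal (2 * δ))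
            (A \ ⋃ x ∈ c, closedBall x (r x)) := by
        have hsub : A ⊆ (⋃ x : c, B x) ∪ (A \ ⋃ x ∈ c, closedBall x (r x)) := by
          intro y hy
          by_cases h : y ∈ ⋃ x ∈ c, closedBall x (r x)
          · left
            simp only [mem_iUnion] at h ⊢
            obtain ⟨x, hx, hyx⟩ := h
            exact ⟨⟨x, hx⟩, hyx⟩
          · exact Or.inr ⟨hy, h⟩
        exact (OuterMeasure.mono _ hsub).trans (measure_union_le _ _)
      -- the rest is `𝓢`-null
      have hrest : OuterMeasure.mkMetric'.pre (sphericalGauge n) (ENNReal.ofReal (2 * δ))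
          (A \ ⋃ x ∈ c, closedBall x (r x)) = 0 := by
        refine le_antisymm ?_ bot_le
        calc OuterMeasure.mkMetric'.pre (sphericalGauge n) (ENNReal.ofReal (2 * δ))
              (A \ ⋃ x ∈ c, closedBall x (r x))
            ≤ 𝓢 (A \ ⋃ x ∈ c, closedBall x (r x)) :=
              pre_le_sphericalMeasure n (ENNReal.ofReal_pos.2 (by linarith)) _
          _ = σ (A \ ⋃ x ∈ c, closedBall x (r x)) := (hσA _ fun y hy => hAM hy.1).symm
          _ = 0 := hcov
      -- the covered part
      have hcovered : OuterMeasure.mkMetric'.pre (sphericalGauge n) (ENNReal.ofReal (2 * δ))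
          (⋃ x : c, B x) ≤ t⁻¹ * σ U := by
        calc OuterMeasure.mkMetric'.pre (sphericalGauge n) (ENNReal.ofReal (2 * δ)) (⋃ x : c, B x)
            ≤ ∑' x : c, unitBallVolume n * ENNReal.ofReal (r x) ^ n :=
              pre_sphericalGauge_le_tsum (fun x : c => (x : V)) (fun x => r x)
                (fun x => ENNReal.ofReal_le_ofReal (by linarith [hrδ x])) Subset.rfl
          _ ≤ ∑' x : c, t⁻¹ * σ (B x) := by
              refine ENNReal.tsum_le_tsum fun x => ?_
              rw [← ENNReal.mul_le_iff_le_inv ht0 httop]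
              exact (hBt x).le
          _ = t⁻¹ * ∑' x : c, σ (B x) := ENNReal.tsum_mul_left
          _ ≤ t⁻¹ * σ U := by
              gcongr
              refine (tsum_meas_le_meas_iUnion_of_disjoint σ
                (fun x => isClosed_closedBall.measurableSet) fun x y hxy => ?_).trans
                (measure_mono (iUnion_subset hBU))
              exact hdisj x.2 y.2 fun h => hxy (Subtype.ext h)
      calc OuterMeasure.mkMetric'.pre (sphericalGauge n) (ENNReal.ofReal (2 * δ)) A
          ≤ t⁻¹ * σ U + 0 := by
            refine hsplit.trans ?_
            rw [hrest]
            exact add_le_add hcovered le_rfl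
        _ ≤ t⁻¹ * (𝓢 A + ε) := by
            rw [add_zero, ← hσA A hAM]
            gcongr
    -- let the mesh go to zero
    rw [show 𝓢 A = (sphericalMeasure n : Measure V) A from rfl, sphericalMeasure_eq_iSup]
    refine iSup_le fun k => ?_
    rcases Nat.eq_zero_or_pos k with rfl | hk
    · -- `k = 0`: `pre ⊤ ≤ pre 2`
      refine (OuterMeasure.mkMetric'.mono_pre _ (show ENNReal.ofReal (2 * 1) ≤ ((0 : ℕ) : ℝ≥0∞)⁻¹
        by simp) A).trans ?_
      refine (hδ 1 one_pos).trans ?_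
      rw [← sphericalMeasure_eq_iSup]
    · have hk' : (0 : ℝ) < (k : ℝ)⁻¹ / 2 := by positivity
      refine (OuterMeasure.mkMetric'.mono_pre _ (show ENNReal.ofReal (2 * ((k : ℝ)⁻¹ / 2)) ≤
        ((k : ℕ) : ℝ≥0∞)⁻¹ by
          rw [mul_div_cancel₀ _ (two_ne_zero), ENNReal.ofReal_inv_of_pos (Nat.cast_pos.2 hk),
            ENNReal.ofReal_natCast]) A).trans ?_
      refine (hδ _ hk').trans ?_
      rw [← sphericalMeasure_eq_iSup]
  -- Conclusion: `𝓢 A (1 - t⁻¹) ≤ 0`.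
  have hle : 𝓢 A ≤ t⁻¹ * 𝓢 A := by
    refine ENNReal.le_of_forall_pos_le_add fun ε hε _ => ?_
    calc 𝓢 A ≤ t⁻¹ * (𝓢 A + ε) := hmain ε (by exact_mod_cast hε.ne')
      _ = t⁻¹ * 𝓢 A + t⁻¹ * ε := mul_add _ _ _
      _ ≤ t⁻¹ * 𝓢 A + 1 * ε := by
          gcongr
          exact ENNReal.inv_le_one.2 ht.le
      _ = t⁻¹ * 𝓢 A + ε := by rw [one_mul]
  by_contra hne
  have hlt : 𝓢 A * t⁻¹ < 𝓢 A * 1 := ENNReal.mul_lt_mul_right hne hAfin (ENNReal.inv_lt_one.2 ht)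
  rw [mul_one, mul_comm] at hlt
  exact (lt_irrefl _) (hlt.trans_le hle)

/-- **Federer 2.10.19 (5) for the spherical measure, sharp constant**: if `M` is measurable with
`𝓢ⁿ(M) < ∞`, then `Θ^{*n}(𝓢ⁿ ⌞ M, x) ≤ 1` for `𝓢ⁿ ⌞ M`-a.e. `x`.
[cite: Federer1969, 2.10.19 (5)] -/
theorem ae_upperDensity_sphericalMeasure_restrict_le_one {M : Set V} (hM : MeasurableSet M)
    (hfin : (sphericalMeasure n : Measure V) M ≠ ⊤) :
    ∀ᵐ x ∂(sphericalMeasure n : Measure V).restrict M,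
      upperDensity n ((sphericalMeasure n : Measure V).restrict M) x ≤ 1 := by
  set σ := (sphericalMeasure n : Measure V).restrict M with hσ
  rw [ae_iff]
  have hsub : {x | ¬upperDensity n σ x ≤ 1} ⊆
      ⋃ k : ℕ, {x | (1 : ℝ≥0∞) + ((k : ℝ≥0∞) + 1)⁻¹ < upperDensity n σ x} := by
    intro x hx
    rw [mem_setOf_eq, not_le] at hx
    rw [mem_iUnion]
    rcases eq_or_ne (upperDensity n σ x) ⊤ with htop | htop
    · refine ⟨0, ?_⟩
      rw [mem_setOf_eq, htop]
      exact ENNReal.add_lt_top.2 ⟨ENNReal.one_lt_top, by simp⟩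
    · have hpos : upperDensity n σ x - 1 ≠ 0 := (tsub_pos_of_lt hx).ne'
      obtain ⟨k, hk⟩ := ENNReal.exists_inv_nat_lt hpos
      refine ⟨k, ?_⟩
      rw [mem_setOf_eq]
      calc (1 : ℝ≥0∞) + ((k : ℝ≥0∞) + 1)⁻¹ ≤ 1 + ((k : ℝ≥0∞))⁻¹ := by
            gcongr; exact le_self_add
        _ < 1 + (upperDensity n σ x - 1) := ENNReal.add_lt_add_left ENNReal.one_ne_top hk
        _ = upperDensity n σ x := add_tsub_cancel_of_le hx.le
  refine measure_mono_null hsub (measure_iUnion_null fun k => ?_)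
  have ht : (1 : ℝ≥0∞) < 1 + ((k : ℝ≥0∞) + 1)⁻¹ :=
    ENNReal.lt_add_right ENNReal.one_ne_top (ENNReal.inv_ne_zero.2 (by simp))
  have httop : (1 : ℝ≥0∞) + ((k : ℝ≥0∞) + 1)⁻¹ ≠ ⊤ :=
    ENNReal.add_ne_top.2 ⟨ENNReal.one_ne_top, ENNReal.inv_ne_top.2 (by positivity)⟩
  rw [hσ, Measure.restrict_apply' hM]
  exact sphericalMeasure_setOf_lt_upperDensity_inter_eq_zero hM hfin ht httop

/-- The same bound in the pointwise-in-radius form used for blow-ups: for `𝓢ⁿ ⌞ M`-a.e. `x` and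
every `t > 1`, eventually (as `r → 0+`) `𝓢ⁿ(M ∩ 𝐁(x, r)) ≤ t α(n) rⁿ`.
[cite: Federer1969, 2.10.19 (5)] -/
theorem ae_eventually_sphericalMeasure_inter_closedBall_le {M : Set V} (hM : MeasurableSet M)
    (hfin : (sphericalMeasure n : Measure V) M ≠ ⊤) :
    ∀ᵐ x ∂(sphericalMeasure n : Measure V).restrict M, ∀ t : ℝ≥0∞, 1 < t →
      ∀ᶠ r in 𝓝[>] (0 : ℝ), (sphericalMeasure n : Measure V) (M ∩ closedBall x r) ≤
        t * (unitBallVolume n * ENNReal.ofReal (r ^ n)) := by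
  filter_upwards [ae_upperDensity_sphericalMeasure_restrict_le_one hM hfin] with x hx t ht
  have h1 : ∀ᶠ r in 𝓝[>] (0 : ℝ), ((sphericalMeasure n : Measure V).restrict M) (closedBall x r) /
      (unitBallVolume n * ENNReal.ofReal (r ^ n)) < t :=
    eventually_lt_of_limsup_lt (hx.trans_lt ht)
  filter_upwards [h1, self_mem_nhdsWithin] with r hr hr0
  rw [Measure.restrict_apply measurableSet_closedBall, inter_comm] at hr
  have hb0 : unitBallVolume n * ENNReal.ofReal (r ^ n) ≠ 0 :=
    mul_ne_zero (unitBallVolume_ne_zero n) (ENNReal.ofReal_pos.2 (pow_pos hr0 n)).ne'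
  have hbtop : unitBallVolume n * ENNReal.ofReal (r ^ n) ≠ ⊤ :=
    ENNReal.mul_ne_top (unitBallVolume_ne_top n) ENNReal.ofReal_ne_top
  exact ((ENNReal.div_lt_iff (Or.inl hb0) (Or.inl hbtop)).1 hr).le

end Density

end Literature.Geometry.GeometricMeasureTheory
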